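import Mathlib
import Summits.Ventures.HodgeRepro2.T6N5Toy
import Summits.Ventures.HodgeRepro2.T6N5Rich

/-!
# T6N5RichToyData — the rich N5 datum ON `N5Toy.toyData` (the two-element toy over `ι = Unit`,
`G = Multiplicative ℤ` of T6N5Toy, the N5 side of the M2 joint toys): a `RichData Unit (Multiplicative ℤ)`
whose skeleton pair IS `toyData`, so that the re-point of a joint toy from `d5 := N5Toy.toyData` to the
rich datum is one equation

Tier 6 (README §10), sub-step N5 of the M2 discharge (t6-p7; t6-lead's ruling STATUS l. 11500 (1)(a): «file
WITH them the TOY INSTANCE `N5Rich` on `N5Toy.toyData` … with its `toN5Data = toyData`»).  The equation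
`toyRich.toN5Data = N5Toy.toyData` is a THEOREM, not `rfl`: `toyData`'s two period Props are the constant
`True`, while a rich side's are `P ≠ 0` and `∃ K, ∃ v ∈ fix K, e v = v ∧ P v ≠ 0` (true on the toy carrier,
and equal to `True` by `propext`); every other field agrees definitionally.  Every hypothesis of
`N5Rich.RichData.N5_of` holds on `toyRich` (`toyRich_joint`), so for a carrier `M` with
`M.d5 = N5Toy.toyData` the binders of `N5RichMain.N5_of_rich` are `toyRich`, `hR := toyRich_toN5Data.symm`
and the conjuncts of `toyRich_joint`.  Count-neutral; no display asserted.
§8(d): uses an L-value-free non-vanishing device: NO.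
-/

namespace Summit.Ventures.HodgeRepro2.T6.N5RichToyData

open Summit.Ventures.HodgeRepro2.T6.N5Skeleton Summit.Ventures.HodgeRepro2.T6.N5Rich
  Summit.Ventures.HodgeRepro2.T6.N5LocalDatum Summit.Ventures.HodgeRepro2.T6.N5Local
  Summit.Ventures.HodgeRepro2.T6.N5Toy

/-- Extensionality for the skeleton's toric sides (the two Prop fields compared as propositions). -/
theorem toricSide_ext {ι G : Type*} [CommGroup G] {X Y : ToricSide ι G}
    (h1 : X.periodNonzero = Y.periodNonzero) (h2 : X.levelPeriodNonzero = Y.levelPeriodNonzero)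
    (h3 : X.β = Y.β) (h4 : X.f = Y.f) (h5 : X.r = Y.r) (h6 : X.omega = Y.omega) (h7 : X.eps = Y.eps)
    (h8 : X.Lval = Y.Lval) : X = Y := by
  cases X
  cases Y
  simp only at h1 h2 h3 h4 h5 h6 h7 h8
  subst h1 h2 h3 h4 h5 h6 h7 h8
  rfl

/-- Extensionality for the skeleton's two-sided data (the compatibility fields are proofs). -/
theorem n5Data_ext {ι G : Type*} [CommGroup G] {D E : N5Data ι G} (hA : D.A = E.A) (hB : D.B = E.B) :
    D = E := by
  cases D
  cases E
  simp only at hA hB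
  subst hA hB
  rfl

/-- The toy representation carrier: `V = ℂ`, one level `⊤`, the identity projector, the identity
functional. -/
def toyRep : RepCarrier where
  V := ℂ
  κ := Unit
  fix := fun _ => ⊤
  e := LinearMap.id
  P := LinearMap.id

/-- The toy carrier satisfies the four construction facts. -/
theorem toyRep_levelHyps : toyRep.LevelHyps where
  smooth := by
    show (⨆ _ : Unit, (⊤ : Submodule ℂ ℂ)) = ⊤
    exact iSup_const
  projector := fun _ => rfl
  stable := fun _ _ _ => trivial
  equivariant := fun _ => rfl

/-- The toy period functional is non-zero. -/
theorem toyRep_periodNonzero : toyRep.periodNonzero := fun h =>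
  one_ne_zero (LinearMap.congr_fun h (1 : ℂ))

/-- (ii) on the toy carrier: the vector `1` of level `()` and type τ′ has `P 1 = 1 ≠ 0`. -/
theorem toyRep_levelPeriodNonzero : toyRep.levelPeriodNonzero :=
  ⟨(), (1 : ℂ), trivial, rfl, one_ne_zero⟩

/-- The toy local sign datum: characters `ℤˣ` with the identity restriction, trivial `η`, root number `+1`
everywhere, trivial `χ_W`, `ϵ_δ(W) = 1`, every theta lift non-zero, trivial line signs. -/
def toyLocal : LocalSignDatum where
  Char := ℤˣ
  FChar := ℤˣ
  res := MonoidHom.id ℤˣ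
  η := 1
  eps := fun _ => 1
  χW := 1
  epsdW := 1
  Theta := fun _ _ => True
  ηLine := fun _ => 1
  ηu := 1

/-- The trivial quadruple solves the toy's coupled local system. -/
theorem toyLocal_solution : LocalSolution toyLocal (fun _ => 1) := by
  refine ⟨fun _ => rfl, rfl, rfl, ?_, ?_, rfl⟩ <;> simp [toyLocal]

/-- The toy sign model over the one place `()`, taken finite non-split, with the toy local datum and
trivial characters. -/
def toySign : SignModel Unit where
  kind := fun _ => PlaceKind.ns
  D := fun _ => toyLocal
  ξ := fun _ _ => 1
  omegaRA := fun _ _ => 1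
  epsRA := fun _ _ => 1
  omegaRB := fun _ _ => 1
  epsRB := fun _ _ => 1

/-- The toy sign model's characters solve the local system at its place. -/
theorem toySign_solves : toySign.Solves := fun _ _ => toyLocal_solution

/-- Condition (b) at the real places holds vacuously (there is none). -/
theorem toySign_realCondB : toySign.RealCondB := fun _ h => nomatch h

/-- THE RICH DATUM ON `N5Toy.toyData`: the toy carrier on both sides, the toy sign model, trivial
characters (`f = rA = rB = 1`), central values `1`. -/
def toyRich : RichData Unit (Multiplicative ℤ) where
  repA := toyRep
  repB := toyRep
  S := toySign
  f := 1
  rA := 1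
  rB := 1
  LvalA := fun _ => 1
  LvalB := fun _ => 1

/-- Side A of the rich toy is `N5Toy.toySide` (the two Props by `propext`, the rest definitionally). -/
theorem toyRich_sideA : toyRich.sideA = toySide :=
  toricSide_ext (eq_true toyRep_periodNonzero) (eq_true toyRep_levelPeriodNonzero) (mul_one _) rfl rfl
    rfl rfl rfl

/-- Side B of the rich toy is `N5Toy.toySide`. -/
theorem toyRich_sideB : toyRich.sideB = toySide :=
  toricSide_ext (eq_true toyRep_periodNonzero) (eq_true toyRep_levelPeriodNonzero) (mul_one _) rfl rfl
    rfl rfl rfl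

/-- THE RE-POINT EQUATION: the rich toy's skeleton pair is `N5Toy.toyData`. -/
theorem toyRich_toN5Data : toyRich.toN5Data = toyData :=
  n5Data_ext toyRich_sideA toyRich_sideB

/-- Every hypothesis of `RichData.N5_of` holds on the rich toy at once (Theorem 5.6's shape on both sides
is `N5Toy.toySide_dichotomy` transported along the re-point equation). -/
theorem toyRich_joint :
    toyRich.sideA.dichotomy ∧ toyRich.sideB.dichotomy ∧ toyRich.LevelHyps ∧ toyRich.SH ∧
      toyRich.S.Solves ∧ toyRich.S.RealCondB ∧ toyRich.toN5Data.condC :=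
  ⟨toyRich_sideA ▸ toySide_dichotomy, toyRich_sideB ▸ toySide_dichotomy,
    ⟨toyRep_levelHyps, toyRep_levelHyps⟩, rfl, toySign_solves, toySign_realCondB,
    toyRich_toN5Data ▸ ⟨toySide_condC, toySide_condC⟩⟩

/-- N5 on the rich toy, through `RichData.N5_of`. -/
theorem toyRich_N5 : toyRich.toN5Data.N5 :=
  toyRich.N5_of toyRich_joint.1 toyRich_joint.2.1 toyRich_joint.2.2.1 toyRich_joint.2.2.2.1
    toyRich_joint.2.2.2.2.1 toyRich_joint.2.2.2.2.2.1 toyRich_joint.2.2.2.2.2.2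

/-- N5 on `N5Toy.toyData` re-derived from the rich toy (consistency with `N5Toy.toyData_N5`). -/
theorem toyData_N5_of_rich : toyData.N5 := toyRich_toN5Data ▸ toyRich_N5

end Summit.Ventures.HodgeRepro2.T6.N5RichToyData
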